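import Mathlib.Analysis.SpecialFunctions.Integrals.Basic
import Mathlib.Algebra.Polynomial.HasseDeriv
import Mathlib.Algebra.Polynomial.Taylor
import HarnessLib

/-!
# Partial fractions at `y₁ = 1/(1−z)`: `∫₀¹ g(y) dy/(1 + y(z−1))^n` for a polynomial `g`

Topic `Literature/NumberTheory/DiophantineApproximation`. Everything here is PROVED (no definitions, no named
facts). Source: G. Rhin, C. Viola, *The permutation group method for the dilogarithm*, Ann. Sc. Norm. Super.
Pisa Cl. Sci. (5) 4 (2005) 389–437, proof of Lemma 2.6 (pp. 399–401): after integrating `I_z^{(0)}(0,0,k,l,0)`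
over `x` first ((2.20)), one is left with one-dimensional integrals `∫₀¹ y^k(1−y)^{l−1} dy/(1+y(z−1))^k`, which
the paper evaluates by the substitution `y = (w−1)/(z−1)` and binomial expansions ((2.21)–(2.22)), a `log z`
appearing from `∫₁^z dw/w`.

We evaluate the general integral `∫₀¹ g(y) dy/(1+y(z−1))^n` (`g ∈ ℝ[y]`, `n ≥ 1`, `z > 1`) by **partial
fractions at the pole** `y₁ = 1/(1−z) < 0`: `1 + y(z−1) = (z−1)(y−y₁)`, `g(y) = Σ_i (D^{(i)}g)(y₁)(y−y₁)^i`
(Taylor; `D^{(i)}` the Hasse derivative), `∫₀¹ (y−y₁)^{e−1} dy = (z^e − 1)(z−1)^{−e}/e` for `e ≠ 0` and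
`∫₀¹ dy/(y−y₁) = log z` (as `1 − y₁ = z/(z−1)`, `−y₁ = 1/(z−1)`):

  `∫₀¹ g(y) dy/(1+y(z−1))^n = Σ_{i≠n−1} (D^{(i)}g)(y₁)·(z^{i−n+1} − 1)(z−1)^{−(i+1)}/(i−n+1)`
      `+ (D^{(n−1)}g)(y₁)·(z−1)^{−n}·log z`.

This form makes the `log z`-coefficient explicit (it is the residue datum `(D^{(n−1)}g)(y₁)`), which is what
lets `I_z = I_z^{(0)} − (log z) I_z^{(1)}` come out free of logarithms in Lemma 2.6.

## References

* G. Rhin, C. Viola, Ann. Sc. Norm. Super. Pisa Cl. Sci. (5) 4 (2005) 389–437, (2.20)–(2.22). [RhinViola2005]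
-/

noncomputable section

namespace Literature.NumberTheory.DiophantineApproximation

namespace RhinViola

open _root_.MeasureTheory _root_.Set intervalIntegral Finset Polynomial

/-- Taylor expansion as a finite sum: `g(y) = Σ_{i<B} (D^{(i)}g)(r)·(y−r)^i` when `deg g < B`. [folklore] -/
theorem eval_eq_sum_hasseDeriv_eval_mul_pow (g : ℝ[X]) {B : ℕ} (hB : g.natDegree < B) (r y : ℝ) :
    g.eval y = ∑ i ∈ range B, (hasseDeriv i g).eval r * (y - r) ^ i := by
  have h := taylor_eval r g (y - r)
  rw [sub_add_cancel] at h
  rw [← h, eval_eq_sum_range' (lt_of_le_of_lt (natDegree_taylor _ _).le hB)]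
  simp only [taylor_coeff]

/-- `∫₀¹ (y − y₁)^m dy` for an integer `m ≠ −1` and `y₁ < 0`:
`= ((1−y₁)^{m+1} − (−y₁)^{m+1})/(m+1)`. [folklore] -/
theorem integral_sub_zpow_of_ne {y₁ : ℝ} (hy : y₁ < 0) {m : ℤ} (hm : m ≠ -1) :
    ∫ y in (0 : ℝ)..1, (y - y₁) ^ m = ((1 - y₁) ^ (m + 1) - (-y₁) ^ (m + 1)) / (m + 1) := by
  rw [intervalIntegral.integral_comp_sub_right (fun u : ℝ => u ^ m) y₁, integral_zpow]
  · simp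
  · refine Or.inr ⟨hm, ?_⟩
    rw [Set.uIcc_of_le (by linarith)]
    exact fun h => by linarith [h.1]

/-- `∫₀¹ dy/(y − y₁) = log((1−y₁)/(−y₁))` for `y₁ < 0`. [folklore] -/
theorem integral_inv_sub {y₁ : ℝ} (hy : y₁ < 0) :
    ∫ y in (0 : ℝ)..1, (y - y₁)⁻¹ = Real.log ((1 - y₁) / (-y₁)) := by
  rw [intervalIntegral.integral_comp_sub_right (fun u : ℝ => u⁻¹) y₁, integral_inv]
  · simp
  · rw [Set.uIcc_of_le (by linarith)]
    exact fun h => by linarith [h.1]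

/-- **Partial fractions at `y₁ = 1/(1−z)`** (`z > 1`, `n ≥ 1`, `deg g < B`, `n ≤ B`):
`∫₀¹ g(y) dy/(1+y(z−1))^n = Σ_{i<B, i≠n−1} (D^{(i)}g)(y₁)(z^{i−n+1} − 1)(z−1)^{−(i+1)}/(i−n+1)
 + (D^{(n−1)}g)(y₁)(z−1)^{−n} log z`. [cite: RhinViola2005, (2.20)–(2.22)] -/
theorem integral_eval_div_pow_eq {z : ℝ} (hz : 1 < z) (g : ℝ[X]) {n B : ℕ} (hn : 1 ≤ n) (hB : g.natDegree < B)
    (hnB : n ≤ B) :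
    ∫ y in (0 : ℝ)..1, g.eval y / (1 + y * (z - 1)) ^ n =
      (∑ i ∈ (range B).erase (n - 1), (hasseDeriv i g).eval (1 / (1 - z)) *
          ((z ^ ((i : ℤ) - n + 1) - 1) * (z - 1) ^ (-((i : ℤ) + 1)) / ((i : ℝ) - n + 1))) +
        (hasseDeriv (n - 1) g).eval (1 / (1 - z)) * ((z - 1) ^ (-(n : ℤ)) * Real.log z) := by
  set y₁ : ℝ := 1 / (1 - z) with hy₁
  have hz1 : z - 1 ≠ 0 := by linarith
  have hz1' : 1 - z ≠ 0 := by linarith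
  have hz0 : z ≠ 0 := by linarith
  have hy₁neg : y₁ < 0 := by rw [hy₁]; exact div_neg_of_pos_of_neg one_pos (by linarith)
  have h1y₁ : 1 - y₁ = z / (z - 1) := by rw [hy₁]; field_simp; ring
  have hny₁ : -y₁ = 1 / (z - 1) := by rw [hy₁]; field_simp; ring
  -- pointwise partial fractions on `[0,1]`
  have hpt : ∀ y ∈ uIcc (0 : ℝ) 1, g.eval y / (1 + y * (z - 1)) ^ n =
      ∑ i ∈ range B, (hasseDeriv i g).eval y₁ * ((z - 1) ^ (-(n : ℤ)) * (y - y₁) ^ ((i : ℤ) - n)) := by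
    intro y hy
    rw [Set.uIcc_of_le zero_le_one] at hy
    have hu : 0 < y - y₁ := by linarith [hy.1]
    have hfac : 1 + y * (z - 1) = (z - 1) * (y - y₁) := by rw [hy₁]; field_simp; ring
    rw [eval_eq_sum_hasseDeriv_eval_mul_pow g hB y₁ y, hfac, sum_div]
    refine sum_congr rfl fun i _ => ?_
    rw [mul_pow, zpow_sub₀ hu.ne', zpow_natCast, zpow_natCast, zpow_neg, zpow_natCast]
    field_simp
  -- integrate termwise
  have hint : ∀ i ∈ range B, IntervalIntegrable
      (fun y : ℝ => (hasseDeriv i g).eval y₁ * ((z - 1) ^ (-(n : ℤ)) * (y - y₁) ^ ((i : ℤ) - n))) volume 0 1 := by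
    intro i _
    refine ContinuousOn.intervalIntegrable ?_
    refine continuousOn_const.mul (continuousOn_const.mul (ContinuousOn.zpow₀
      (by fun_prop : Continuous fun y : ℝ => y - y₁).continuousOn _ fun y hy => Or.inl ?_))
    rw [Set.uIcc_of_le zero_le_one] at hy
    exact (by linarith [hy.1] : (0 : ℝ) < y - y₁).ne'
  rw [integral_congr hpt, integral_finsetSum hint]
  simp_rw [intervalIntegral.integral_const_mul]
  have hmem : n - 1 ∈ range B := mem_range.2 (by omega)
  rw [← add_sum_erase _ _ hmem, add_comm]
  congr 1
  · refine sum_congr rfl fun i hi => ?_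
    have hi' : i ≠ n - 1 := (mem_erase.1 hi).1
    have hm : ((i : ℤ) - n) ≠ -1 := by omega
    rw [integral_sub_zpow_of_ne hy₁neg hm, h1y₁, hny₁, div_zpow, div_zpow, one_zpow]
    have e1 : (z - 1) ^ (-((i : ℤ) + 1)) = (z - 1) ^ (-(n : ℤ)) * ((z - 1) ^ ((i : ℤ) - n + 1))⁻¹ := by
      rw [← zpow_neg, ← zpow_add₀ hz1]
      congr 1
      ring
    rw [e1]
    have hzw : (z - 1) ^ ((i : ℤ) - n + 1) ≠ 0 := zpow_ne_zero _ hz1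
    push_cast
    field_simp
  · congr 1
    rw [show ((n - 1 : ℕ) : ℤ) - n = -1 by omega]
    simp_rw [zpow_neg_one]
    rw [integral_inv_sub hy₁neg, h1y₁, hny₁]
    congr 1
    field_simp

end RhinViola

end Literature.NumberTheory.DiophantineApproximation

end
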